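import Literature.AnabelianGeometry.AbsoluteAnabelian.AbsTopILem27iiiStepOfSigmaStarProofs
import Literature.AnabelianGeometry.AbsoluteAnabelian.AbsTopIThm26iiiAlmostProPackage
import Literature.AnabelianGeometry.AbsoluteAnabelian.ProfiniteCompletionPi
import Literature.AnabelianGeometry.AbsoluteAnabelian.ProfiniteRankProofs
import HarnessLib

/-!
# [AbsTopI] Thm 2.6 (iii)/(v) from (∗)_Σ for `Δ` ALMOST pro-`Σ` — the count forms at print's Def 2.1 reading

S. Mochizuki, *Topics in Absolute Anabelian Geometry I: Generalities* (2012) [AbsTopI]: Def 1.1 (iii) p. 10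
("almost pro-`Σ`"), Def 2.1 (i)/(ii) p. 17 ("[geometrically almost pro-`Σ`] AFG-type"), Thm 2.6 (iii)/(v)
p. 22, proof p. 23–24.

PROOF-ONLY file (no definitions, no named facts) of the abc-iut row «HOOK-FROM-SIGMA-STAR», follow-up (α)
(abc-iut-L4-lead RULING #8j (6)+(7); seat abc-iut-w6-d074): the Lemma 2.7 (iii) step being a theorem of
(∗)_Σ + splitting + Prop 2.2 + MLF base (`lem27iiiStep_of_sigmaStarCondition`, which uses NO pro-`Σ`
hypothesis), abc-iut-w6-d075's almost-pro-`Σ` package (`AbsTopIThm26iiiAlmostProPackage.lean`, clause one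
by abc-iut-w6-d071) yields the typed nodes at print's construction-datum reading "`Δ` ALMOST pro-`Σ`"
(`IsAlmostPro E.geom S`) instead of "`Δ` pro-`Σ`":
* `thm26iii_of_sigmaStarCondition_of_isAlmostPro` (+ `_of_geomTFG`, + `thm26iii_open_…`) — the typed
  [AbsTopI] Thm 2.6 (iii), both clauses;
* `MLFBase.thm26vFull_of_sigmaStarCondition_of_isAlmostPro` (+ `_of_geomTFG`) — the typed general-`Θ`
  [AbsTopI] Thm 2.6 (v), every `Σ ⊆ Primes`.
Inputs, all BY NAME: MLF base data, Prop 2.2 (`E.GeomTFG`), `Δ` almost pro-`Σ`, `Π` tfg (or `G` tfg),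
splitting over an open subgroup of `G`, (∗)_Σ.  These are the count forms recorded in abc-iut-L4-t11's
read of record (probe `ProbeThm26iiiSigmaStar.lean`, M3–M5), now in the tree.
HONEST FRAMING: refereed, undisputed paper; (∗)_Σ and the splitting are hypotheses on data; nothing here
bears on [IUTchIII] Cor. 3.12; typed ≠ proved elsewhere.
-/

noncomputable section

namespace Literature.AnabelianGeometry.AbsoluteAnabelian

namespace FundamentalExtension

variable {E : FundamentalExtension.{0}}

/-- **[AbsTopI] Thm 2.6 (iii) (typed, both clauses) for `Δ` ALMOST pro-`Σ`, from (∗)_Σ** — MLF base data,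
Prop 2.2, `Π` tfg, `Δ` almost pro-`Σ`, splitting, (∗)_Σ. [cite: MochizukiAbsTopI2012, Thm 2.6 (iii) p.22] -/
theorem thm26iii_of_sigmaStarCondition_of_isAlmostPro (B : E.MLFBase) {S : Set ℕ} (hΔ : E.GeomTFG)
    (htfg : IsTopologicallyFinitelyGenerated E.arith) (hpro : IsAlmostPro E.geom S)
    (hs : E.SplitsOverOpenSubgroup) (hstar : E.SigmaStarCondition S) : E.Thm26iii S :=
  thm26iii_of_lem27iiiStep_of_isAlmostPro B htfg hpro (lem27iiiStep_of_sigmaStarCondition B hΔ hs hstar)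

/-- The same with "`Π` tfg" supplied from Prop 2.2 and "`G` tfg" ([NSW] 7.5.10).
[cite: MochizukiAbsTopI2012, Thm 2.6 (iii) p.22] -/
theorem thm26iii_of_sigmaStarCondition_of_isAlmostPro_of_geomTFG (B : E.MLFBase) {S : Set ℕ}
    (hΔ : E.GeomTFG) (hG : IsTopologicallyFinitelyGenerated E.gal) (hpro : IsAlmostPro E.geom S)
    (hs : E.SplitsOverOpenSubgroup) (hstar : E.SigmaStarCondition S) : E.Thm26iii S :=
  thm26iii_of_sigmaStarCondition_of_isAlmostPro B hΔ
    (IsTopologicallyFinitelyGenerated.of_extension E.aug E.aug_surjective hΔ hG) hpro hs hstar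

/-- **Thm 2.6 (iii) at every open `H ⊆ Π` for `Δ` ALMOST pro-`Σ`, from (∗)_Σ** (both clauses).
[cite: MochizukiAbsTopI2012, Thm 2.6 (iii) p.22] -/
theorem thm26iii_open_of_sigmaStarCondition_of_isAlmostPro (B : E.MLFBase) {S : Set ℕ}
    (hΔ : E.GeomTFG) (htfg : IsTopologicallyFinitelyGenerated E.arith) (hpro : IsAlmostPro E.geom S)
    (hs : E.SplitsOverOpenSubgroup) (hstar : E.SigmaStarCondition S) :
    ∀ (H : Subgroup E.arith), IsOpen (H : Set E.arith) →
      thetaSet ↥H 2 ⊆ {l ∈ S | l.Prime} ∧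
        (2 ≤ (thetaSet ↥H 1).encard → thetaSet ↥H 2 = {l ∈ S | l.Prime}) :=
  thm26iii_open_of_lem27iiiStep_of_isAlmostPro B htfg hpro
    (lem27iiiStep_of_sigmaStarCondition B hΔ hs hstar)

/-- **[AbsTopI] Thm 2.6 (v), GENERAL form, every `Σ ⊆ Primes`, for `Δ` ALMOST pro-`Σ`, from (∗)_Σ** —
MLF base data, Prop 2.2, `Π` tfg, `Δ` almost pro-`Σ`, splitting, (∗)_Σ; the (ii)-rank identity and the
Lemma 2.7 (iii) step both come from (∗)_Σ + splitting. [cite: MochizukiAbsTopI2012, Thm 2.6 (v) p.22] -/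
theorem MLFBase.thm26vFull_of_sigmaStarCondition_of_isAlmostPro (B : E.MLFBase) (S : Set ℕ)
    (hS : S ⊆ {q | q.Prime}) (hΔ : E.GeomTFG) (htfg : IsTopologicallyFinitelyGenerated E.arith)
    (hΔS : IsAlmostPro E.geom S) (hs : E.SplitsOverOpenSubgroup) (hstar : E.SigmaStarCondition S) :
    E.Thm26vFull B :=
  MLFBase.thm26vFull_of_sigmaStarCondition_of_lem27iiiStep_of_isAlmostPro B S hS hΔ htfg hΔS hs hstar
    fun _ => lem27iiiStep_of_sigmaStarCondition B hΔ hs hstar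

/-- The same with "`Π` tfg" supplied from Prop 2.2 and "`G` tfg".
[cite: MochizukiAbsTopI2012, Thm 2.6 (v) p.22] -/
theorem MLFBase.thm26vFull_of_sigmaStarCondition_of_isAlmostPro_of_geomTFG (B : E.MLFBase)
    (S : Set ℕ) (hS : S ⊆ {q | q.Prime}) (hΔ : E.GeomTFG)
    (hG : IsTopologicallyFinitelyGenerated E.gal) (hΔS : IsAlmostPro E.geom S)
    (hs : E.SplitsOverOpenSubgroup) (hstar : E.SigmaStarCondition S) : E.Thm26vFull B :=
  MLFBase.thm26vFull_of_sigmaStarCondition_of_isAlmostPro B S hS hΔ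
    (IsTopologicallyFinitelyGenerated.of_extension E.aug E.aug_surjective hΔ hG) hΔS hs hstar

end FundamentalExtension

end Literature.AnabelianGeometry.AbsoluteAnabelian
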